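import Summits.KontsevichZagierPeriods.KontsevichZagierPeriods.Theorems.FurushoPentagonReducedPeriodRingPiSplit

/-!
# `ReducedPeriodRing` (stmt-KontsevichZagierPeriods-3929) is EXACTLY the square-zero shadow of the
# `[π]`-localisation pair (`KZ.PiLocalKernel`, `KZ.PiCancellation`)

Support file for crux `FurushoPentagon.ReducedPeriodRing` (the formal period ring
`P = KZ.FormalRep ⧸ KZ.relations` of the Kontsevich–Zagier calculus has no nilpotents), landed
`--supports stmt-KontsevichZagierPeriods-3929` by line lead c4 as the kernel-checked form of the
lineage's terminal census line.

Route AyoubSpecialisation splits the kernel conjecture along `[π]` into the two OPEN statements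
`KZ.PiLocalKernel` (item stmt-KontsevichZagierPeriods-0541: `eval c = 0 → ∃ N, [π]^N ⋆ c ∈ relations`)
and `KZ.PiCancellation` (item stmt-KontsevichZagierPeriods-0540: `[π] ⋆ c ∈ relations → c ∈ relations`).
`Theorems/FurushoPentagonReducedPeriodRingPiSplit.lean` glued the crux from child 1 = "0541 with
`eval c = 0` strengthened to `c * c ∈ relations`" and child 2 = 0540 VERBATIM (all `c`).
Here the second child is cut down to square-zero classes as well, and the cut becomes an
EQUIVALENCE:

* `reducedPeriodRing_iff_sqZero_shadow` —
  `ReducedPeriodRing ↔ (∀ c, c*c ∈ rel → ∃ N, ([π] ⋆ ·)^[N] c ∈ rel) ∧ (∀ c, c*c ∈ rel → [π] ⋆ c ∈ rel → c ∈ rel)`: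
  the crux is precisely "0541 restricted to square-zero classes ∧ 0540 restricted to square-zero
  classes". The backward direction peels one `[π]` at a time, which is legitimate because
  square-zero is stable under `[π] ⋆ ·` (`iterate_piMul_sq_mem_relations`, from
  `ReducedPeriodRingPiSplit.piMul_sq_mem_relations`); the forward direction is `N = 0` / trivial.
* `sqZero_piLocal_of_piLocalKernel`, `sqZero_piCancel_of_piCancellation` — each restricted
  conjunct follows from the corresponding unrestricted open statement (for the first:
  `c * c ∈ relations ⇒ eval c = 0` by `KZ.eval_mul'` and soundness).
* `reducedPeriodRing_of_piLocalKernel_of_piCancellation` — hence `PiLocalKernel → PiCancellation →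
  ReducedPeriodRing` (the crux sits below the thesis pair stmt-KontsevichZagierPeriods-0538 of route
  AyoubSpecialisation, as it sits below `KZKernelConjecture`).

So item 0540 itself is NOT a necessary leaf of the crux — only its square-zero restriction is; but
that restriction is as unsourced as 0540 (no move-calculus technique certifies `c ∈ relations` from
`[π] ⋆ c ∈ relations`, with or without `c * c ∈ relations`; the abstract drop-one models of
`Theorems/ReducedPeriodRing/Negative/LineLoadBearing.lean` separate the two conjuncts). Nothing here
claims either conjunct.

References: M. Kontsevich, D. Zagier, *Periods* (2001), §1.2, §4.1 (`P̂ = P[(2πi)⁻¹]`); J. Ayoub,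
*Periods and the conjectures of Grothendieck and Kontsevich–Zagier*, EMS Newsl. 91 (2014), Def. 6,
Conj. 7; A. Huber, G. Wüstholz, *Transcendence and linear relations of 1-periods* (2022), App. A.4.
-/

noncomputable section

namespace Summit.KontsevichZagierPeriods.FurushoPentagon.ReducedPeriodRingNilShadow

open Literature.NumberTheory.Transcendental Literature.NumberTheory.Transcendental.KZ
open Summit.KontsevichZagierPeriods.KontsevichZagierPeriods.Theses.FurushoPentagon
open Summit.KontsevichZagierPeriods.FurushoPentagon.ReducedPeriodRingPiSplit

/-- Square-zero is stable under every iterate of `[π] ⋆ ·`: if `c * c ∈ relations` then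
`(([π] ⋆ ·)^[N] c)² ∈ relations` for all `N` (iterate `piMul_sq_mem_relations`). [folklore] -/
theorem iterate_piMul_sq_mem_relations {c : FormalRep} (hc : c * c ∈ relations) (N : ℕ) :
    (fun x => of piRep * x)^[N] c * (fun x => of piRep * x)^[N] c ∈ relations := by
  induction N with
  | zero => simpa using hc
  | succ N ih =>
    simpa only [Function.iterate_succ_apply'] using piMul_sq_mem_relations ih

/-- **The crux is the square-zero shadow of the `[π]`-localisation pair.** `ReducedPeriodRing`
holds iff (i) every square-zero class becomes a relation after enough multiplications by `[π]`
(= `KZ.PiLocalKernel`, item 0541, restricted to square-zero classes; ring-theoretically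
`IsReduced P[1/[π]]`) and (ii) `[π] ⋆ ·` reflects relations ON SQUARE-ZERO CLASSES
(= `KZ.PiCancellation`, item 0540, restricted to square-zero classes). Backward: peel the `N`
factors `[π]` one at a time — each intermediate iterate is again square-zero by
`iterate_piMul_sq_mem_relations`, so the restricted cancellation applies; forward: `N = 0`, resp.
the crux's conclusion ignores the extra hypothesis. [cite: KontsevichZagier2001, §4.1] -/
theorem reducedPeriodRing_iff_sqZero_shadow :
    ReducedPeriodRing ↔
      (∀ c : FormalRep, c * c ∈ relations → ∃ N : ℕ, (fun x => of piRep * x)^[N] c ∈ relations) ∧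
      (∀ c : FormalRep, c * c ∈ relations → of piRep * c ∈ relations → c ∈ relations) := by
  constructor
  · intro h
    exact ⟨fun c hc => ⟨0, h c hc⟩, fun c hc _ => h c hc⟩
  · rintro ⟨hnil, hpc⟩ c hc
    obtain ⟨N, hN⟩ := hnil c hc
    induction N with
    | zero => simpa using hN
    | succ N ih =>
      refine ih ?_
      exact hpc _ (iterate_piMul_sq_mem_relations hc N)
        (by simpa only [Function.iterate_succ_apply'] using hN)

/-- Conjunct (i) follows from `KZ.PiLocalKernel` (item stmt-KontsevichZagierPeriods-0541): a square
that is a relation evaluates to `0` (`KZ.eval_mul'`, soundness `KZ.relations_le_ker_eval_holds`),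
so its root lies in `ker eval`. [folklore] -/
theorem sqZero_piLocal_of_piLocalKernel (hloc : PiLocalKernel) :
    ∀ c : FormalRep, c * c ∈ relations → ∃ N : ℕ, (fun x => of piRep * x)^[N] c ∈ relations := by
  intro c hc
  refine hloc c ?_
  have h0 : eval (c * c) = 0 := relations_le_ker_eval_holds hc
  rw [eval_mul'] at h0
  exact mul_self_eq_zero.mp h0

/-- Conjunct (ii) follows from `KZ.PiCancellation` (item stmt-KontsevichZagierPeriods-0540) by
forgetting the square-zero hypothesis. [folklore] -/
theorem sqZero_piCancel_of_piCancellation (hpc : PiCancellation) :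
    ∀ c : FormalRep, c * c ∈ relations → of piRep * c ∈ relations → c ∈ relations :=
  fun c _ h => hpc c h

/-- Hence the crux lies below the thesis pair of route AyoubSpecialisation
(stmt-KontsevichZagierPeriods-0538 = 0541 ∧ 0540): `PiLocalKernel → PiCancellation →
ReducedPeriodRing`. [cite: KontsevichZagier2001, §4.1] -/
theorem reducedPeriodRing_of_piLocalKernel_of_piCancellation (hloc : PiLocalKernel)
    (hpc : PiCancellation) : ReducedPeriodRing :=
  reducedPeriodRing_iff_sqZero_shadow.mpr
    ⟨sqZero_piLocal_of_piLocalKernel hloc, sqZero_piCancel_of_piCancellation hpc⟩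

end Summit.KontsevichZagierPeriods.FurushoPentagon.ReducedPeriodRingNilShadow
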